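import Literature.NumberTheory.EllipticCurves.ZpExtensionEisensteinTwistRestrictedDualityInstanceProofs
import Literature.NumberTheory.GaloisCohomology.Howard2004.DualityDatumRestrictedPairingProofs
import Literature.NumberTheory.EllipticCurves.ZpExtensionEisensteinDVRSetting
import HarnessLib

/-!
# H.4 at `v ∣ p` for the curve's Eisenstein tower: the restricted local pairing
# `H¹(K_v, Fil_v W_{k+1}) × H¹(K_v, Tw W_{k+1} / δ_v·Fil_{σv} W_{k+1}) → H²(K_v, A_{m,k+1}(1))` exists and is non-degenerate on
# both sides (TURNKEY; theorems only; no definition, no named fact, no instance, no `sorry`)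

Topic `NumberTheory/EllipticCurves` (cell `pub/bsd-print-x9`; brick (B3) of `HOME/p1/H4-EXACT-AT-P-PLAN` assembled into ONE statement in
the binders of the D1 assembly / (HY-FRAMES) export, for the (B6) limit-exactness step (Exact) at `v ∣ p` of Howard's H.4 for `F_𝔮`).

Howard [Compositio Math. 140 (2004), §1.3 H.4, Lemma 3.1.1, Def. 3.2.6; arXiv:1202.6340 p. 7 L69–82, p. 15 L56–62, p. 16 L108–110]:
at `v ∣ p` the local condition is the (saturated) image of `H¹(K_v, Fil_v T_𝔮)`, `Fil_v T_𝔮` is its own exact orthogonal complement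
under `e_𝔮`, and the local conditions are exact orthogonal complements under the local Tate pairing.  For the D-family's level-`k`
datum `D` on `W_{k+1} = E_K[p^{k+1}] ⊗ A_{m,k+1}(ψ)` (`κ.eisensteinTwist E_K[p^{k+1}] hm (k+1) = (W.eisensteinTower κ hm).ρ k` by `rfl`) with
`D.e = eisensteinDualityForm hm (k+1) (conjPairing e τ_* log)`:

* **`WeierstrassCurve.eisensteinTower_restrictedPairing_nondegenerate`** — given the (HY-FRAMES) facts on `e`/`log`/`τ_*` (alternating,
  right-non-degenerate [x9-p1-w4's `weilLog_nondegenerate_of_dualityDatum_e_eq`], `log` bijective and `χ`-equivariant, `τ_*` involutive),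
  `IsOrdinaryAt W p`, `p ∈ v`, and the stability proofs `hV`/`hV′` of the plus part `V = A ⊗ Fil_v E[p^{k+1}]`
  (`OrdinaryFiltration.twistedFil`) and of the transported plus part `V′ = W_{k+1}(δ_v) · (A ⊗ Fil_{σv} E[p^{k+1}])`:
  there is a restricted pairing `P` on the tree's carriers `(GaloisRep.toLocal v _).subrepresentation V hV` ×
  `(GaloisRep.toLocal v (cd.twist _)).quotient V′ hV′` with `P(s, [t]) = D.e s t`, and BOTH kernels of `P.cupProduct` are trivial.
  Chain: `DualityDatum.exists_restrictedPairing` + `restrictedPairing_eq_zero_of_forall_cupProduct_eq_zero_right/left`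
  (`Howard2004/DualityDatumRestrictedPairingProofs`, PROVED local duality) ∘ `eisensteinDualityForm_torsionFilAt_restricted_perfect_of_isOrdinaryAt`
  + `ZpExtension.map_eisensteinTwist_span_tmul` (`…RestrictedDualityInstanceProofs`) with `λ = tailFormZMod`, `exp = log⁻¹`.

No summit statement is proved; BSD is not proved by any of this.  Seat `bsd-line-x10b-p1-w7` g2.

References: [Howard2004HeegnerKolyvagin] §1.3 H.4, Lemma 2.1.1, §3.1, Lemma 3.1.1, Def. 3.2.6 (arXiv:1202.6340 p. 7, p. 15, p. 16);
[MilneADT2006] I Cor. 2.3; [SerreGaloisCohomology1997] II §5.2 Thm. 2; [GreenbergLNM1716] §2.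
-/

set_option autoImplicit false

noncomputable section

open scoped TensorProduct ContRepresentation NumberField
open Function NumberField IsDedekindDomain Field

namespace WeierstrassCurve

open Literature.NumberTheory.EllipticCurves Literature.NumberTheory.GaloisRepresentations
open Literature.NumberTheory.GaloisRepresentations.DiscreteGaloisModule
open Literature.NumberTheory.GaloisCohomology.Howard2004 Literature.NumberTheory.EllipticCurves.IwasawaAlgebra
open Literature.NumberTheory.EllipticCurves.ZpExtension

variable {K : Type} [Field K] [NumberField K] (W : WeierstrassCurve ℚ) [W.IsElliptic] [W.IsGloballyMinimal] {p : ℕ}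
  [hp : Fact p.Prime] (κ : ZpExtension K p) {m : ℕ} (hm : 1 ≤ m)
  (σ : K ≃ₐ[ℚ] K) (hσ₁ : σ ≠ 1) (hσ : σ * σ = 1) (τ : AlgebraicClosure K ≃+* AlgebraicClosure K)
  (hτ : IsLiftOfAut σ τ) (hτ₂ : Function.Involutive τ)

/-- **The restricted local pairing of H.4 at `v ∣ p` for the curve's Eisenstein tower exists and is non-degenerate on both sides**
(TURNKEY for the (Exact)-at-`p` descent): see the module docstring.  `V`/`V′` are the plus part at `v` and the `δ_v`-transport of the
plus part at `σ v` of the level `W_{k+1} = κ.eisensteinTwist E_K[p^{k+1}] hm (k+1)` (`= (W.eisensteinTower κ hm).ρ k`, `rfl`), given by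
their defining equations `hVdef`/`hV'def` (pass `rfl`) for ANY presentation `t, ht` of the transitions (the plus parts only see
`Fil_v E[p^{k+1}]`), with their stability proofs `hV`, `hV′` supplied by the caller (`OrdinaryFiltration.twistedFil_le_comap`,
`ConjugationDatum.map_delta_le_comap_twist`).
[cite: Howard2004HeegnerKolyvagin, §1.3 H.4, Lemma 3.1.1 and Def. 3.2.6 (arXiv:1202.6340 p. 7 L78–82, p. 15 L60–62, p. 16 L108–110)]
[cite: MilneADT2006, I Cor. 2.3] [cite: SerreGaloisCohomology1997, II §5.2 Thm. 2] -/
theorem eisensteinTower_restrictedPairing_nondegenerate (hordW : IsOrdinaryAt W p) (v : HeightOneSpectrum (𝓞 K))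
    (hpv : ((p : ℕ) : 𝓞 K) ∈ v.asIdeal) [CharZero (v.adicCompletion K)] (k : ℕ)
    (t : ∀ j, ((W.baseChange K).torsionGaloisModule ((p : ℤ) ^ (j + 1))).toContRepresentation →ⁱL
      ((W.baseChange K).torsionGaloisModule ((p : ℤ) ^ j)).toContRepresentation)
    (ht : ∀ j (P : geomTorsion (W.baseChange K) ((p : ℤ) ^ (j + 1))), t j P = (W.baseChange K).geomTorsionReduce p j P)
    (D : DualityDatum p (ConjugationDatum.ofLifts σ hσ₁ hσ τ hτ hτ₂)
      (κ.eisensteinTwist ((W.baseChange K).torsionGaloisModule ((p : ℤ) ^ (k + 1))) hm (k + 1))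
      (EisensteinCoeff p m (k + 1)))
    (e : geomTorsion (W.baseChange K) ((p : ℤ) ^ (k + 1)) →+ geomTorsion (W.baseChange K) ((p : ℤ) ^ (k + 1)) →+
      MuCarrier K (p ^ (k + 1)))
    (log : MuCarrier K (p ^ (k + 1)) →+ ZMod (p ^ (k + 1)))
    (hDe : D.e = eisensteinDualityForm hm (k + 1) (conjPairing e (hτ.torsionMap W ((p : ℤ) ^ (k + 1))) log))
    (halt : ∀ a, e a a = 0) (hnd : ∀ b, (∀ a, e a b = 0) → b = 0)
    (hθθ : ∀ a : geomTorsion (W.baseChange K) ((p : ℤ) ^ (k + 1)), hτ.torsionMap W _ (hτ.torsionMap W _ a) = a)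
    (hlog : Bijective log)
    (hlogχ : ∀ (g : absoluteGaloisGroup K) ξ, log (mu K (p ^ (k + 1)) g ξ) = cyclotomicCharacterModPow K p (k + 1) g * log ξ)
    (V V' : Submodule ℤ (EisensteinCoeff.Twisted p m (k + 1) (geomTorsion (W.baseChange K) ((p : ℤ) ^ (k + 1)))))
    (hVdef : V = ((W.baseChange K).ordinaryFiltrationAt v t ht).twistedFil (m := m) (k + 1))
    (hV'def : V' = (((W.baseChange K).ordinaryFiltrationAt (σ • v) t ht).twistedFil (m := m) (k + 1)).map
      ((κ.eisensteinTwist ((W.baseChange K).torsionGaloisModule ((p : ℤ) ^ (k + 1))) hm (k + 1))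
        ((ConjugationDatum.ofLifts σ hσ₁ hσ τ hτ hτ₂).δ v)))
    (hV : ∀ g : absoluteGaloisGroup (v.adicCompletion K), V ≤ V.comap
      (GaloisRep.toLocal v (κ.eisensteinTwist ((W.baseChange K).torsionGaloisModule ((p : ℤ) ^ (k + 1))) hm (k + 1)) g))
    (hV' : ∀ g : absoluteGaloisGroup (v.adicCompletion K), V' ≤ V'.comap
      (GaloisRep.toLocal v ((ConjugationDatum.ofLifts σ hσ₁ hσ τ hτ hτ₂).twist
        (κ.eisensteinTwist ((W.baseChange K).torsionGaloisModule ((p : ℤ) ^ (k + 1))) hm (k + 1))) g)) :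
    ∃ P : ContPairing
        ((GaloisRep.toLocal v (κ.eisensteinTwist ((W.baseChange K).torsionGaloisModule ((p : ℤ) ^ (k + 1))) hm
          (k + 1))).subrepresentation V hV).toTopRep
        ((GaloisRep.toLocal v ((ConjugationDatum.ofLifts σ hσ₁ hσ τ hτ hτ₂).twist
          (κ.eisensteinTwist ((W.baseChange K).torsionGaloisModule ((p : ℤ) ^ (k + 1))) hm (k + 1)))).quotient
          V' hV').toTopRep
        (GaloisRep.toLocal v D.twistOne).toTopRep,
      (∀ s (t : EisensteinCoeff.Twisted p m (k + 1) (geomTorsion (W.baseChange K) ((p : ℤ) ^ (k + 1)))),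
          P.toLin s (Submodule.Quotient.mk t) = D.e (s : _) t) ∧
      (∀ y, (∀ x, P.cupProduct x y = 0) → y = 0) ∧ (∀ x, (∀ y, P.cupProduct x y = 0) → x = 0) := by
  haveI : NeZero (p ^ (k + 1)) := ⟨pow_ne_zero _ hp.out.ne_zero⟩
  haveI : Finite (geomTorsion (W.baseChange K) ((p : ℤ) ^ (k + 1))) :=
    finite_torsionPoints_holds (W.baseChange K) (AlgebraicClosure K)
      (pow_ne_zero _ (Nat.cast_ne_zero.mpr hp.out.ne_zero))
  haveI : Finite (EisensteinCoeff.Twisted p m (k + 1) (geomTorsion (W.baseChange K) ((p : ℤ) ^ (k + 1)))) :=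
    EisensteinCoeff.finite_twisted hm
  -- the three module-level clauses for `E = eisensteinDualityForm hm (k+1) ẽ` on the spans
  have hclauses := W.eisensteinDualityForm_torsionFilAt_restricted_perfect_of_isOrdinaryAt hm σ hσ₁ hσ τ hτ hτ₂
    hordW v hpv (k + 1) e log hlog.1 halt hnd hθθ
  obtain ⟨horth, hR, hS⟩ := hclauses
  -- identify the submodules: `V` is the span (rfl) and `V′` is the span of the `δ_v`-translate
  have hVeq : V = Submodule.span ℤ {x | ∃ (c : EisensteinCoeff p m (k + 1))
      (a : geomTorsion (W.baseChange K) ((p : ℤ) ^ (k + 1))),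
        a ∈ (W.baseChange K).torsionFilAt v ((p : ℤ) ^ (k + 1)) ∧ x = EisensteinCoeff.Twisted.tmul c a} := hVdef
  have hV'eq : V' = Submodule.span ℤ {x | ∃ (c : EisensteinCoeff p m (k + 1))
      (b : geomTorsion (W.baseChange K) ((p : ℤ) ^ (k + 1))),
        b ∈ ((W.baseChange K).torsionFilAt (σ • v) ((p : ℤ) ^ (k + 1))).map
          ((W.baseChange K).torsionGaloisModule ((p : ℤ) ^ (k + 1)) ((ConjugationDatum.ofLifts σ hσ₁ hσ τ hτ hτ₂).δ v)) ∧
        x = EisensteinCoeff.Twisted.tmul c b} := by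
    rw [hV'def]
    exact ZpExtension.map_eisensteinTwist_span_tmul κ ((W.baseChange K).torsionGaloisModule ((p : ℤ) ^ (k + 1))) hm (k + 1)
      ((W.baseChange K).torsionFilAt (σ • v) ((p : ℤ) ^ (k + 1))) ((ConjugationDatum.ofLifts σ hσ₁ hσ τ hτ hτ₂).δ v)
  have horth' : ∀ s ∈ V, ∀ t ∈ V', D.e s t = 0 := by
    intro s hs t ht
    rw [hVeq] at hs
    rw [hV'eq] at ht
    rw [hDe]
    exact horth s hs t ht
  have hP0 := D.exists_restrictedPairing v V hV V' hV' horth'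
  obtain ⟨P, hP⟩ := hP0
  -- the reading `λ = tailFormZMod`, `exp = log⁻¹`
  have hM : ∀ x : EisensteinCoeff.Twisted p m (k + 1) (geomTorsion (W.baseChange K) ((p : ℤ) ^ (k + 1))),
      (p ^ (k + 1)) • x = 0 := fun x ↦ EisensteinCoeff.prime_pow_nsmul_twisted x
  let lam : EisensteinCoeff p m (k + 1) →+ ZMod (p ^ (k + 1)) := (EisensteinCoeff.tailFormZMod p hm (k + 1)).toAddMonoidHom
  have hlam : ∀ (z : ℤ_[p]) (r : EisensteinCoeff p m (k + 1)),
      lam (algebraMap ℤ_[p] (EisensteinCoeff p m (k + 1)) z * r) = PadicInt.toZModPow (k + 1) z * lam r := by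
    intro z r
    change EisensteinCoeff.tailFormZMod p hm (k + 1) _ = _ * EisensteinCoeff.tailFormZMod p hm (k + 1) r
    rw [EisensteinCoeff.algebraMap_padicInt_eq_ofZMod_toZModPow p hm (k + 1), EisensteinCoeff.tailFormZMod_ofZMod_mul]
  let E : MuCarrier K (p ^ (k + 1)) ≃+ ZMod (p ^ (k + 1)) := AddEquiv.ofBijective log hlog
  let exp : ZMod (p ^ (k + 1)) →+ MuCarrier K (p ^ (k + 1)) := E.symm.toAddMonoidHom
  have hexp : ∀ (g : absoluteGaloisGroup K) (x : ZMod (p ^ (k + 1))),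
      exp (cyclotomicCharacterModPow K p (k + 1) g * x) = mu K (p ^ (k + 1)) g (exp x) := by
    intro g x
    apply hlog.1
    have h1 : log (exp x) = x := E.apply_symm_apply x
    have h2 : log (exp (cyclotomicCharacterModPow K p (k + 1) g * x)) = cyclotomicCharacterModPow K p (k + 1) g * x :=
      E.apply_symm_apply _
    rw [hlogχ, h1, h2]
  have hexpb : Bijective exp := E.symm.bijective
  have hR' : ∀ t, (∀ s ∈ V, lam (D.e s t) = 0) → t ∈ V' := by
    intro t ht
    rw [hV'eq]
    refine hR t fun s hs ↦ ?_
    have h := ht s (by rw [hVeq]; exact hs)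
    rw [hDe] at h
    exact h
  have hS' : ∀ φ : V →+ ZMod (p ^ (k + 1)), ∃ t, ∀ s : V, lam (D.e (s : _) t) = φ s := by
    subst hVeq
    intro φ
    obtain ⟨t, ht⟩ := hS φ
    refine ⟨t, fun s ↦ ?_⟩
    rw [hDe]
    exact ht s
  refine ⟨P, hP, fun y hy ↦ ?_, fun x hx ↦ ?_⟩
  · exact DualityDatum.restrictedPairing_eq_zero_of_forall_cupProduct_eq_zero_right lam hlam exp hexp hexpb P hP hM hR' hS'
      y hy
  · exact DualityDatum.restrictedPairing_eq_zero_of_forall_cupProduct_eq_zero_left lam hlam exp hexp hexpb P hP hM hR' hS'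
      x hx

end WeierstrassCurve

end
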